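import Mathlib.Algebra.MvPolynomial.Degrees
import Mathlib.Algebra.MvPolynomial.Eval
import Mathlib.Data.Real.Basic
import Mathlib.Data.Fintype.Pi
import Literature.Computability.Cryptography.QuantumQuery
import HarnessLib
import HarnessLib.Audit

/-!
# The Aaronson–Ambainis conjecture and classical simulation of quantum query algorithms

Trunk CryptoQuantFine, topic `Literature/Computability/QuantumComplexity`; wanted by route
`QuantumAdvantage/AvgCase`.

S. Aaronson, A. Ambainis, *The need for structure in quantum speedups*, Theory of Computing 10
(2014), 133–166. Numbering: the declarations below follow the single counter of arXiv:0911.0996v3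
(the journal text: §1, Conjecture 4, Conjecture 6, Theorem 7); in the Theory of Computing
offprint these are Conjecture 1.5 (p. 136), Conjecture 1.7 (p. 139) and Theorem 1.8 (p. 139)
(proofs: Thm. 3.3 p. 153; L¹/L² equivalence Prop. 6.2 p. 160; equivalent form of Conj. 1.5 as
Conj. 7.1 / Thm. 7.3, p. 161):

* **Conjecture 6 (Bounded polynomials have influential variables).** Let `p : ℝ^N → ℝ` be a
  polynomial of degree `d` with `0 ≤ p(X) ≤ 1` for all `X ∈ {0,1}^N` and
  `E_X[(p(X) - E[p])²] ≥ ε`. Then there exists `i` with `Inf_i[p] ≥ (ε/d)^{O(1)}`, where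
  `Inf_i[p] = E_X[(p(X) - p(X^i))²]` (`X^i` = `X` with the `i`-th bit flipped) — the
  **Aaronson–Ambainis conjecture** (`AAConjecture`).
* **Conjecture 4 (folklore).** For every quantum algorithm `Q` making `T` queries to
  `X ∈ {0,1}^N` and every `ε, δ > 0` there is a deterministic classical algorithm making
  `poly(T, 1/ε, 1/δ)` queries that approximates `Q`'s acceptance probability to within additive
  error `ε` on a `1 - δ` fraction of inputs (uniform distribution) — `QuantumQuerySimulable`.
* **Theorem 7 (i).** Conjecture 6 implies Conjecture 4 — the named fact
  `AaronsonAmbainis2014_thm7`.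

Both conjectures are `def … : Prop` (never asserted); the theorem is a named fact whose statement
is the implication, so routes use `(h7 : AaronsonAmbainis2014_thm7) (hAA : AAConjecture)`.

## Status of the two conjectures (verdict clean-up, 2026-08-15)

`AAConjecture` and `QuantumQuerySimulable` are REGISTERED OPEN STATEMENTS (CONVENTIONS §4: an open
conjecture is a `def … : Prop`, used only as a hypothesis), not literature debt: there is and can
be no `AAConjecture_holds` / `QuantumQuerySimulable_holds` until the problems are solved in print.
Their docstrings begin `OPEN CONJECTURE —`, cite where each is POSED, and carry `[status: open]`;
the Lean statements are unchanged (re-read 2026-08-15 against the ToC offprint, pp. 136–140,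
153, 158, 160–161, and the arXiv v3 TeX source, `\label{folkloreconj}` / `\label{infconj}`). Both
KEEP their names (in particular `QuantumQuerySimulable` is not renamed `…Conjecture`) because they
have in-tree users: `AaronsonAmbainis2014_thm7` below, `AaronsonAmbainisProofs.lean` (which
DISCHARGES Theorem 7 (i) as
`AaronsonAmbainis2014_thm7_holds : AAConjecture → QuantumQuerySimulable`),
`AaronsonAmbainisSimTreeBounds.lean`, `AaronsonAmbainisThm23*.lean`, `InfluenceBounds.lean`, and
the barrier files `Literature/Barriers/QuantumAdvantage/{RandomOracleMethod,
RandomOracleMethodThm23, TotalFunctionSpeedupLimit}.lean`. Evidence that both are open as of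
2026-08: the source itself lists "prove Conjecture 1.7" as the open problem of its §4 (p. 158);
only special cases are proved —
Boolean-valued `p` / decision trees (O'Donnell–Saks–Schramm–Servedio 2005, Thm. 1.9 loc. cit.),
the `2^{O(d)}` version (Dinur–Friedgut–Kindler–O'Donnell, Thm. 1.10 loc. cit.), Fourier
coefficients of equal magnitude (Montanaro 2012, §1.3 loc. cit.), completely bounded
block-multilinear forms (Bansal–Sinha–de Wolf, CCC 2022, arXiv:2203.00212), homogeneous Fourier
completely bounded polynomials (Escudero Gutiérrez, Chicago J. TCS 2024:2, arXiv:2304.06713),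
random restrictions (Bhattacharya, ITCS 2025, arXiv:2402.13952); the claimed proof of Keller–Klein
(arXiv:1911.03748, Nov. 2019) was withdrawn by its authors (v2 comment: "our proof contains a
serious flaw … Lemma 5.3 does not prove the assertion it claims"); and the conjecture is recalled
as open in Slote–Volberg–Zhang, arXiv:2608.04411 (Aug. 2026), §5 ("Classical Aaronson–Ambainis
conjecture (62) is open") and, in the equivalent form Conj. 7.1 of Conjecture 1.5, in
Huffstutler–Kapshikar–Miloschewsky–Podder, arXiv:2603.29256 (2026), Conjecture 2.

## Rendering

* Quantum query algorithms are the tree's `Literature.Computability.Cryptography.QQueryAlg N`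
  (Beals et al. model, `QuantumQuery.lean`) with `Q.queries = T` and `Q.acceptProb x`
  (`QQueryAlg 0` is empty, so the `N = 0` instances below are vacuous).
* A "deterministic classical algorithm approximating a probability" is a decision tree with real
  leaves, `RealDecisionTree N` (the Boolean `Literature.Computability.Complexity.DecisionTree`
  cannot output reals), with `eval` and `depth` (= number of adaptive queries on the worst path).
* Expectations over the uniform distribution on `{0,1}^N` are finite averages `boolAvg`;
  polynomials are `MvPolynomial (Fin N) ℝ` evaluated at `0/1` points (`evalBool`), degree
  `totalDegree`.
* `(ε/d)^{O(1)}` and `poly(T, 1/ε, 1/δ)` hide universal constants; they are rendered by leading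
  existential constants (`∃ c C, …` resp. `∃ C k, …`) quantified *before* everything else, which
  is exactly the uniformity the sources intend.

## References

* S. Aaronson, A. Ambainis, *The need for structure in quantum speedups*, Theory Comput. 10
  (2014), 133–166; arXiv:0911.0996v3, §1 (Conj. 4, Conj. 6, Thm. 7).
* R. Beals, H. Buhrman, R. Cleve, M. Mosca, R. de Wolf, *Quantum lower bounds by polynomials*,
  J. ACM 48 (2001), §2 (query model, `acceptProb` is a degree-`2T` polynomial).
-/

noncomputable section

open Finset

namespace Literature.Computability.QuantumComplexity

open Cryptography

variable {N : ℕ}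

/-! ### Averages over the Boolean cube, Boolean evaluation of real polynomials, influences -/

/-- The uniform average `E_{X ∈ {0,1}^N} f(X) = 2^{-N} ∑_X f(X)`.
[cite: AaronsonAmbainis2014, §1 (Conjecture 6)] -/
def boolAvg (f : (Fin N → Bool) → ℝ) : ℝ :=
  (∑ x : Fin N → Bool, f x) / (2 : ℝ) ^ N

/-- The average of a constant. [folklore] -/
@[simp] theorem boolAvg_const (c : ℝ) : boolAvg (fun _ : Fin N → Bool => c) = c := by
  simp [boolAvg, Fintype.card_bool, Fintype.card_fin]

/-- The average of a nonnegative function is nonnegative. [folklore] -/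
theorem boolAvg_nonneg {f : (Fin N → Bool) → ℝ} (hf : ∀ x, 0 ≤ f x) : 0 ≤ boolAvg f :=
  div_nonneg (Finset.sum_nonneg fun x _ => hf x) (by positivity)

/-- Evaluation of a real polynomial in `N` variables at a point of the Boolean cube
(`true ↦ 1`, `false ↦ 0`). [cite: AaronsonAmbainis2014, §1 (Conjecture 6)] -/
def evalBool (p : MvPolynomial (Fin N) ℝ) (x : Fin N → Bool) : ℝ :=
  MvPolynomial.eval (fun i => if x i then (1 : ℝ) else 0) p

/-- `X^i`: the input `X` with its `i`-th bit flipped.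
[cite: AaronsonAmbainis2014, §1 (Conjecture 6)] -/
def flipBit (i : Fin N) (x : Fin N → Bool) : Fin N → Bool :=
  Function.update x i (!x i)

/-- Flipping twice is the identity. [folklore] -/
@[simp] theorem flipBit_flipBit (i : Fin N) (x : Fin N → Bool) : flipBit i (flipBit i x) = x := by
  funext j
  by_cases h : j = i
  · subst h; simp [flipBit]
  · simp [flipBit, h]

/-- The variance `Var[p] = E_X[(p(X) - E[p])²]` of `p` on the uniform Boolean cube.
[cite: AaronsonAmbainis2014, §1 (Conjecture 6)] -/
def boolVariance (p : MvPolynomial (Fin N) ℝ) : ℝ :=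
  boolAvg fun x => (evalBool p x - boolAvg (evalBool p)) ^ 2

/-- The (`L²`-)influence `Inf_i[p] = E_X[(p(X) - p(X^i))²]` of the `i`-th variable.
[cite: AaronsonAmbainis2014, §1 (definition of Inf_i before Conjecture 6)] -/
def influence (i : Fin N) (p : MvPolynomial (Fin N) ℝ) : ℝ :=
  boolAvg fun x => (evalBool p x - evalBool p (flipBit i x)) ^ 2

/-- Influences are nonnegative. [folklore] -/
theorem influence_nonneg (i : Fin N) (p : MvPolynomial (Fin N) ℝ) : 0 ≤ influence i p :=
  boolAvg_nonneg fun _ => sq_nonneg _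

/-- The variance is nonnegative. [folklore] -/
theorem boolVariance_nonneg (p : MvPolynomial (Fin N) ℝ) : 0 ≤ boolVariance p :=
  boolAvg_nonneg fun _ => sq_nonneg _

/-! ### Conjecture 6: the Aaronson–Ambainis conjecture -/

/-- OPEN CONJECTURE — **the Aaronson–Ambainis conjecture** ("Bounded Polynomials Have Influential
Variables"), POSED in S. Aaronson, A. Ambainis, *The need for structure in quantum speedups*,
Theory of Computing 10 (2014) 133–166 as Conjecture 1.7, p. 139 (= Conjecture 6 of
arXiv:0911.0996v3; the `L¹` form of the 2009/ICS 2011 versions is Conjecture 6.1 there, equivalent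
by Proposition 6.2, p. 160), attributed to "Aaronson, 2008; Aaronson and Ambainis, 2011" in
O'Donnell, *Analysis of Boolean Functions*, Ch. 8 notes ("`MaxInf[f] ≥ poly(Var[f]/deg(f))`")
[cite: AaronsonAmbainis2014, Conjecture 1.7 (ToC 10 p. 139) = arXiv v3 Conjecture 6]
[status: open]: "Let `p : ℝ^N → ℝ` be a polynomial of degree `d`. Suppose that `0 ≤ p(X) ≤ 1`
for all `X ∈ {0,1}^N`, and `E_X[(p(X) − E[p])²] ≥ ε`. Then there exists an `i` such that
`Inf_i[p] ≥ (ε/d)^{O(1)}`", where `Inf_i[p] := E_X[(p(X) − p(X^i))²]`. Rendering: there are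
universal constants `c ∈ ℕ`, `C > 0` (the printed `(ε/d)^{O(1)}`) such that for every `N`, every
degree bound `d ≥ 1`, every real polynomial `p` in `N` variables of total degree `≤ d` with
`0 ≤ p(X) ≤ 1` on `{0,1}^N`, and every `ε > 0` with `Var[p] ≥ ε`, some variable has
`Inf_i[p] ≥ C · (ε/d)^c`. STATUS: no proof in print — the source lists it as THE open problem of
its §4 (p. 158); only special cases are proved (Boolean-valued `p`, Thm. 1.9; the `2^{O(d)}` bound,
Thm. 1.10; Montanaro 2012; Bansal–Sinha–de Wolf arXiv:2203.00212; Escudero Gutiérrez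
arXiv:2304.06713; Bhattacharya arXiv:2402.13952), the Keller–Klein proof claim arXiv:1911.03748
(2019) was withdrawn, and Slote–Volberg–Zhang arXiv:2608.04411 (2026-08, §5) still call it open —
see the module docstring. Hence there is no `AAConjecture_holds`; use only as a hypothesis
`(hAA : AAConjecture)`. Name and Lean statement unchanged (users listed in the module docstring);
verdict of the tenured prove-seat (open problem) re-verified 2026-08-15. -/
@[conjecture] def AAConjecture : Prop :=
  ∃ (c : ℕ) (C : ℝ), 0 < C ∧ ∀ (N d : ℕ) (p : MvPolynomial (Fin N) ℝ) (ε : ℝ), 1 ≤ d →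
    p.totalDegree ≤ d → (∀ x, 0 ≤ evalBool p x ∧ evalBool p x ≤ 1) → 0 < ε →
      ε ≤ boolVariance p → ∃ i : Fin N, C * (ε / d) ^ c ≤ influence i p

/-! ### Conjecture 4: classical simulation of quantum query algorithms on most inputs -/

/-- Deterministic classical query algorithms with real output: decision trees on `N` bits whose
leaves carry a real number (the estimate of an acceptance probability).
[cite: AaronsonAmbainis2014, §1 (Conjecture 4)] -/
inductive RealDecisionTree (N : ℕ) : Type
  /-- output the real number `r` -/
  | leaf (r : ℝ) : RealDecisionTree N
  /-- query bit `i` and continue with `t₀` (bit `false`) or `t₁` (bit `true`) -/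
  | query (i : Fin N) (t₀ t₁ : RealDecisionTree N) : RealDecisionTree N

namespace RealDecisionTree

/-- The output of the tree on input `x`. [cite: AaronsonAmbainis2014, §1 (Conjecture 4)] -/
def eval : RealDecisionTree N → (Fin N → Bool) → ℝ
  | leaf r, _ => r
  | query i t₀ t₁, x => if x i then t₁.eval x else t₀.eval x

/-- The depth (worst-case number of queries) of the tree.
[cite: AaronsonAmbainis2014, §1 (Conjecture 4)] -/
def depth : RealDecisionTree N → ℕ
  | leaf _ => 0
  | query _ t₀ t₁ => max t₀.depth t₁.depth + 1

/-- A leaf makes no queries. [folklore] -/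
@[simp] theorem depth_leaf (r : ℝ) : (leaf r : RealDecisionTree N).depth = 0 := rfl

/-- A leaf outputs its label. [folklore] -/
@[simp] theorem eval_leaf (r : ℝ) (x : Fin N → Bool) : (leaf r : RealDecisionTree N).eval x = r :=
  rfl

end RealDecisionTree

/-- OPEN CONJECTURE — **every quantum query algorithm can be simulated classically on most inputs**
(folklore; "which we were aware of since about 1999"), POSED in print in S. Aaronson, A. Ambainis,
*The need for structure in quantum speedups*, Theory of Computing 10 (2014) 133–166 as
Conjecture 1.5, p. 136 (= Conjecture 4 of arXiv:0911.0996v3; equivalent total-function form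
Conjecture 7.1, Thm. 7.3, p. 161)
[cite: AaronsonAmbainis2014, Conjecture 1.5 (ToC 10 p. 136) = arXiv v3 Conjecture 4]
[status: open]: "Let `Q` be a quantum algorithm that makes `T` queries to a Boolean input
`X = (x₁, …, x_N)`, and let `ε > 0`. Then there exists a deterministic classical algorithm that
makes `poly(T, 1/ε, 1/δ)` queries to the `xᵢ`'s, and that approximates `Q`'s acceptance
probability to within an additive error `ε` on a `1 − δ` fraction of inputs." Rendering: there
are universal constants `C, k` such that for every `N`, every quantum query algorithm `Q` on `N`
bits with `T = Q.queries` queries and all `ε, δ ∈ (0, 1]`, there is a deterministic decision tree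
of depth at most `C · (T/(ε δ) + 1)^k` (i.e. `poly(T, 1/ε, 1/δ)` queries) whose output is within
`ε` of `Q`'s acceptance probability on all but at most a `δ` fraction of the `2^N` inputs.
STATUS: never proved in print. It FOLLOWS from `AAConjecture` (Thm. 1.8 (i) = arXiv v3 Thm. 7 (i),
proved as Thm. 3.3 p. 153; in the tree the named fact `AaronsonAmbainis2014_thm7` below,
discharged downstream in `AaronsonAmbainisProofs.lean`), which is itself open; unconditionally
only special classes of algorithms are covered (`2^{O(T)}` classical queries via Thm. 1.10;
algorithms with completely bounded block-multilinear / homogeneous Fourier completely bounded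
acceptance polynomials, Bansal–Sinha–de Wolf arXiv:2203.00212 and Escudero Gutiérrez
arXiv:2304.06713); the Keller–Klein derivation arXiv:1911.03748 (2019) was withdrawn with its
proof of the influence conjecture; recalled as a conjecture (form 7.1) in
Huffstutler–Kapshikar–Miloschewsky–Podder arXiv:2603.29256 (2026), Conjecture 2 — see the module
docstring. Hence there is no `QuantumQuerySimulable_holds`; use only as a hypothesis or through
`quantumQuerySimulable_of_AAConjecture`. Name KEPT (not renamed `…Conjecture`: users
`AaronsonAmbainis2014_thm7`, `AaronsonAmbainisProofs.lean`); Lean statement unchanged; verdict of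
the tenured prove-seat (open conjecture) re-verified 2026-08-15. -/
@[conjecture] def QuantumQuerySimulable : Prop :=
  ∃ (C k : ℕ), ∀ (N : ℕ) (Q : QQueryAlg N) (ε δ : ℝ), 0 < ε → ε ≤ 1 → 0 < δ → δ ≤ 1 →
    ∃ t : RealDecisionTree N,
      (t.depth : ℝ) ≤ C * ((Q.queries : ℝ) / (ε * δ) + 1) ^ k ∧
      ((Finset.univ.filter fun x : Fin N → Bool => ε < |t.eval x - Q.acceptProb x|).card : ℝ)
        ≤ δ * (2 : ℝ) ^ N

/-! ### Theorem 7 (i): the conjecture implies classical simulability -/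

/-- **Aaronson–Ambainis 2014, Theorem 7 (i)** ("Assume Conjecture 6. Then (i) Conjecture 4
holds."): the Aaronson–Ambainis conjecture on influential variables of bounded low-degree
polynomials implies that every `T`-query quantum algorithm is `ε`-approximated on a `1 - δ`
fraction of inputs by a deterministic classical algorithm making `poly(T, 1/ε, 1/δ)` queries.
(Consequence for average-case quantum advantage: under `AAConjecture`, black-box decision
separations under the uniform input distribution are impossible; ensembles must be structured.)
A theorem in print (ToC 10: Thm. 1.8 (i), proved as Thm. 3.3, p. 153), recorded as a named fact
(an implication between the two `Prop`s) and DISCHARGED downstream as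
`AaronsonAmbainis2014_thm7_holds` in `AaronsonAmbainisProofs.lean` (which imports this file).
[cite: AaronsonAmbainis2014, Thm. 7 (i)] -/
def AaronsonAmbainis2014_thm7 : Prop :=
  AAConjecture → QuantumQuerySimulable

/-- Route form: from the named fact and the conjecture, classical simulability. [folklore] -/
theorem quantumQuerySimulable_of_AAConjecture (h7 : AaronsonAmbainis2014_thm7)
    (hAA : AAConjecture) : QuantumQuerySimulable :=
  h7 hAA

/-- Sanity check of `QuantumQuerySimulable`'s bookkeeping: the trivial tree `leaf r` has depth
`0 ≤ C · (…)^k`, so the depth clause is always satisfiable and the content of the conjecture is the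
approximation clause. [folklore] -/
theorem depth_leaf_le (C k : ℕ) (T : ℕ) {ε δ : ℝ} (hε : 0 < ε) (hδ : 0 < δ) (r : ℝ) :
    ((RealDecisionTree.leaf r : RealDecisionTree N).depth : ℝ) ≤
      C * ((T : ℝ) / (ε * δ) + 1) ^ k := by
  simp only [RealDecisionTree.depth_leaf, Nat.cast_zero]
  positivity

end Literature.Computability.QuantumComplexity
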